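import Summits.CriticalPhenomena.PercolationContinuityZ3.Theorems.PercNearOneGluingNoHeavyLowerTailSahiCombTriWCommonBottom
import Summits.CriticalPhenomena.PercolationContinuityZ3.Theorems.PercNearOneGluingNoHeavyLowerTailSahiCombTriWCompression

/-!
# The ANTI-ordered one-fibre functional is bounded below by minus the test-shell: `triWOne(P; ∅, A; B', B) ≥ −#(P ∩ (B' \ B))`

Support file of the one-cut programme (crux `NoHeavyLowerTail`, stmt-CriticalPhenomena-4575; cell `prim-masterthm`, seat P5 gen 28;
memo `FROM-prim-masterthm-p5-g28-HALFCHAIN-CERTIFICATES.md` §2).  In the independent-middles normal form of `TRI_W(2)`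
(`FiveUpSet.triW_two_eq_fourMid`, `…TriWHalfChainMid`) the summand of the index `{a}` on the half-chain stratum `G{a} ⊆ G{b}` is the
one-fibre functional `M(F{a}; G{b}, G{a}) = triWOne(P; ∅, F{a}; G{b}, G{a})` with the `G`-pair in the ANTI order (large member first);
unlike the nested order (`FiveUpSet.triWOne_mid_nonneg`, ≥ 0 by the five-up-set theorem) it can be negative.  This file proves the sharp-in-shape
lower bound

* **`FiveUpSet.triWOne_antiMid_ge`** — for up-sets `P, A, B ⊆ B'` of a finite cube: `-#(P ∩ (B' \ B)) ≤ triWOne c P ∅ A B' B`, i.e.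
  `#(P ∩ B' ∩ refl A) + #(P ∩ A ∩ refl B') ≤ #(P ∩ (B' \ B)) + 2·#(P ∩ A ∩ B) + #(P ∩ refl (A ∩ (B' \ B)))` (four free up-sets, `B ⊆ B'`).
  Certificate (found by exact LP column generation over five-up-set atoms with lattice arguments, P5 gen 28): the two THREE-up-set instances
  `fiveUpSetIneq_holds (P ∩ A) A univ ∅ B'` and `fiveUpSetIneq_holds A (P ∩ A) P ∅ B` (test set `A`, nested pair `P ∩ A ⊆ P` — the test set `P`
  used as a nested argument) plus a remainder that is non-negative on every antipodal pair (`sum_nonneg_of_compl_pair`, kernel `decide`).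
  Exhaustively checked beforehand on all up-sets of `2^n`, `n ≤ 4` (2.1·10⁸ configurations), random `n ≤ 6`.
* `FiveUpSet.chainPos` — position code of a point in a 2-chain (bookkeeping for the `decide`; single sets: `LatticeFiveUpSet.mem_code`).
HONEST LABEL: one new elementary inequality (a lemma for the half-chain stratum `HalfChainMidIneq`, which remains OPEN). [this work]
-/

namespace Summit.CriticalPhenomena.PercolationContinuityZ3.Theorems

namespace FiveUpSet

open Finset LatticeFiveUpSet

variable {γ : Type} [DecidableEq γ] [Fintype γ]

omit [Fintype γ] in
/-- Position of a point in a 2-chain `B ⊆ B'`, coded in `Fin 3` (`0`: outside `B'`; `1`: in `B' \ B`; `2`: in `B`). [this work] -/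
theorem chainPos {B B' : Finset (Finset γ)} (h : B ⊆ B') (w : Finset γ) :
    ∃ s : Fin 3, (w ∈ B ↔ s = 2) ∧ (w ∈ B' ↔ (s = 1 ∨ s = 2)) := by
  by_cases hb : w ∈ B
  · exact ⟨2, by simp [hb, h hb]⟩
  · by_cases hb' : w ∈ B'
    · exact ⟨1, by simp [hb, hb']⟩
    · exact ⟨0, by simp [hb, hb']⟩

set_option synthInstance.maxHeartbeats 400000 in
set_option synthInstance.maxSize 4096 in
set_option maxHeartbeats 800000 in
/-- **Lower bound for the anti-ordered one-fibre functional.**  For up-sets `P, A, B ⊆ B'` of a finite cube,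
`-#(P ∩ (B' \ B)) ≤ triWOne c P ∅ A B' B` (`c` = complementation).  Two three-up-set instances + an antipodal-pair remainder. [this work] -/
theorem triWOne_antiMid_ge (P A B B' : Finset (Finset γ)) (hP : IsUpperSet (P : Set (Finset γ))) (hA : IsUpperSet (A : Set (Finset γ)))
    (hB : IsUpperSet (B : Set (Finset γ))) (hB' : IsUpperSet (B' : Set (Finset γ))) (hBB' : B ⊆ B') :
    -((P ∩ (B' \ B)).card : ℤ) ≤ triWOne (complEquiv γ) P ∅ A B' B := by
  rw [triWOne_expand]
  have hW : IsUpperSet ((univ : Finset (Finset γ)) : Set (Finset γ)) := by rw [coe_univ]; exact isUpperSet_univ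
  have hE : IsUpperSet ((∅ : Finset (Finset γ)) : Set (Finset γ)) := isUpperSet_empty
  have hPA : IsUpperSet ((P ∩ A : Finset (Finset γ)) : Set (Finset γ)) := by rw [coe_inter]; exact hP.inter hA
  have h1 := fiveUpSetIneq_holds γ (P ∩ A) A univ ∅ B' hPA hA hW hE hB' (subset_univ _) (empty_subset _)
  have h1' : 0 ≤ ((((P ∩ A) ∩ univ ∩ B').card : ℤ) + (((P ∩ A) ∩ A ∩ ∅).card : ℤ) - (((P ∩ A) ∩ univ ∩ refl ∅).card : ℤ) - (((P ∩ A) ∩ refl A ∩ B').card : ℤ) - (((P ∩ A) ∩ refl (univ \ A) ∩ refl (B' \ ∅)).card : ℤ)) := by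
    have := h1; omega
  have h2 := fiveUpSetIneq_holds γ A (P ∩ A) P ∅ B hA hPA hP hE hB inter_subset_left (empty_subset _)
  have h2' : 0 ≤ (((A ∩ P ∩ B).card : ℤ) + ((A ∩ (P ∩ A) ∩ ∅).card : ℤ) - ((A ∩ P ∩ refl ∅).card : ℤ) - ((A ∩ refl (P ∩ A) ∩ B).card : ℤ) - ((A ∩ refl (P \ (P ∩ A)) ∩ refl (B \ ∅)).card : ℤ)) := by
    have := h2; omega
  have hR : 0 ≤ 1 * ((2 * (((P ∩ ∅ ∩ B').card : ℤ) + ((P ∩ A ∩ B).card : ℤ)) - (((P ∩ refl ∅ ∩ B).card : ℤ) + ((P ∩ refl A ∩ B').card : ℤ)) - (((P ∩ ∅ ∩ refl B).card : ℤ) + ((P ∩ A ∩ refl B').card : ℤ)) - (((P ∩ refl ∅ ∩ refl B').card : ℤ) + ((P ∩ refl A ∩ refl B).card : ℤ)) + (((P ∩ refl ∅ ∩ refl B).card : ℤ) + ((P ∩ refl A ∩ refl B').card : ℤ))) + ((P ∩ (B' \ B)).card : ℤ)) - (1 * ((((P ∩ A) ∩ univ ∩ B').card : ℤ) + (((P ∩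 A) ∩ A ∩ ∅).card : ℤ) - (((P ∩ A) ∩ univ ∩ refl ∅).card : ℤ) - (((P ∩ A) ∩ refl A ∩ B').card : ℤ) - (((P ∩ A) ∩ refl (univ \ A) ∩ refl (B' \ ∅)).card : ℤ)) + 1 * (((A ∩ P ∩ B).card : ℤ) + ((A ∩ (P ∩ A) ∩ ∅).card : ℤ) - ((A ∩ P ∩ refl ∅).card : ℤ) - ((A ∩ refl (P ∩ A) ∩ B).card : ℤ) - ((A ∩ refl (P \ (P ∩ A)) ∩ refl (B \ ∅)).card : ℤ))) := by
    simp only [card_eq_univ_sum]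
    simp only [mem_inter, mem_refl, mem_sdiff, Finset.notMem_empty, Finset.mem_univ]
    simp only [mul_add, mul_sub]
    simp only [Finset.mul_sum, ← Finset.sum_add_distrib, ← Finset.sum_sub_distrib]
    refine sum_nonneg_of_compl_pair (fun w => ?_)
    simp only [compl_compl]
    obtain ⟨s₁, a1⟩ := mem_code A w
    obtain ⟨s₂, b2, b1⟩ := chainPos hBB' w
    obtain ⟨s₃, c1⟩ := mem_code A wᶜ
    obtain ⟨s₄, d2, d1⟩ := chainPos hBB' wᶜ
    simp only [a1, b2, b1, c1, d2, d1]
    clear a1 b2 b1 c1 d2 d1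
    by_cases hp : w ∈ P <;> by_cases hq : wᶜ ∈ P <;> simp only [hp, hq] <;> (revert s₁ s₂ s₃ s₄; decide)
  linarith [hR, h1', h2']

end FiveUpSet

end Summit.CriticalPhenomena.PercolationContinuityZ3.Theorems
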